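/-
COR-CM (cell pub-hodgecm2, stage 2 of the Hodge ladder) — count-neutral KERNEL COMBINATORICS «μ = φ₂ for every split index-two cyclic datum of
2-power level, ALL twists at once» (seat prover-pub-hodgecm2-b23-g49-0, binder prover b23, gen 49; own census lane INDEX-TWO CYCLIC LAW, claim
HOME/INBOX.md l.22678, LANE RECORD l.22835; capstone). Theorems only; the lane files `Census/IndexTwoCyclic*` (this seat), the dihedral law
`Census/DihedralLaw.lean` (seat b23 gen 48) and the field transfer `CorCM/FaceGenerationTransfer.lean` are used BY NAME; nothing asserted.
HONEST FRAMING: `HC_CM` is NOT proved, here or anywhere in the tree; this file produces no period and proves no face period for any field.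
T5: n/a-class — the only Prop hypothesis binders are the index-two cyclic datum (inhabited: `Census/IndexTwoCyclicInstance.lean`), `n = 2 ^ a` with
`a ≠ 0`, `c·c = 1`, `c ≠ 1`, and at field level the automorphism hypotheses of `CorCM/FaceIndexTwoCyclicGeneration.lean` §2; no named-fact /
conjecture-def binder; checker: self (prover-pub-hodgecm2-b23-g49-0), 2026-08-25.
-/
import Summits.HodgeConjecture.CorCM.Census.IndexTwoCyclicSquareTwist
import Summits.HodgeConjecture.CorCM.Census.IndexTwoCyclicBlockCount
import Summits.HodgeConjecture.CorCM.Census.DihedralLaw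
import Summits.HodgeConjecture.CorCM.FaceIndexTwoCyclicGeneration
import HarnessLib

/-!
# The index-two cyclic census at 2-power level: `μ = φ₂` for EVERY twist

Let `D : IndexTwoCyclic.Datum G c n` (`Census/IndexTwoCyclicDatum.lean`): `u` of order `2n` with `uⁿ = c`, `[G : ⟨u⟩] = 2`, an involution
`w ∉ ⟨u⟩` with `w·u = uʳ·w` — `G ≅ ℤ/2n ⋊_r ℤ/2`.  At 2-POWER LEVEL `n = 2ᵃ` (`a ≥ 1`, so `|G| = 2^{a+2}` and `⟨u⟩` is a cyclic maximal
subgroup) the census closes for ALL twists `r` with NO side condition: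

* §1 **the involution dichotomy** (`two_mul_dvd_r_add_one_of_notMem`): `c = u^{2ᵃ}` is the unique involution of the cyclic 2-group `⟨u⟩` and
  lies in every non-trivial subgroup of it (`Census/IndexTwoCyclicBlockCount.lean`, `c_mem_zpowers_pow`), so EITHER `c ∈ ⟨u^{r+1}⟩` — the twist
  hypothesis of the INDEX-TWO CYCLIC LAW (`Census/IndexTwoCyclicLaw.lean`: `μ = β − 1 = φ₂`; abelian `r = 1`, modular `r = n + 1`, semidihedral
  `r = n − 1`, …) — OR `u^{r+1} = 1`, i.e. `r ≡ −1 (mod 2n)`: then every element outside `⟨u⟩` is an involution (`mul_self_eq_one_of_dvd`) and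
  `D` IS a dihedral datum (`Census/DihedralDatum.lean`), where seat b23 gen 48ʼs DIHEDRAL LAW gives `μ = β − 2 = φ₂`
  (`Census/DihedralLaw.lean`).
* §2 **`isLeast_card_gfaces_generate_fibreTwo_of_two_pow`**: hence `μ(G, c) = φ₂(G, c)` for every such datum, every twist; block currency
  `isLeast_card_gfaces_generate_of_two_pow : μ = β − (1 if c ∈ ⟨u^{r+1}⟩ else 2)`; structure-free form
  `isLeast_card_gfaces_generate_fibreTwo_of_involution_two_pow` (from `u, w` alone).  Together with the cyclic column (seat b23 gen 38, `ℤ/2ᵏ`)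
  and the quaternion column (seat b09, `Q_{2ᵏ}`) this is `μ = φ₂` for every 2-group with a cyclic maximal subgroup and `c` the involution of that
  subgroup, the four split families `ℤ/2^{k−1} × ℤ/2, D_{2ᵏ}, SD_{2ᵏ}, M_{2ᵏ}` being handled HERE uniformly (no classification is invoked: the
  statement quantifies over the datum).
* §3 **field level** (`isLeast_card_faces_hgen_of_aut_two_pow`): a Galois CM field `F` with `[F:ℚ] = 2^{a+2}`, `u₀ ∈ Aut F` of order `2^{a+1}` with
  `u₀^{2ᵃ}` inducing complex conjugation at `σ₀`, and an involution `w₀ ∉ ⟨u₀⟩`: the least number of faces satisfying INT2-GENʼs generation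
  binder is EXACTLY `φ₂(F)` — every Galois CM field of 2-power degree whose Galois group has a cyclic subgroup of index two containing complex
  conjugation and split by an involution (cyclotomic `ℚ(ζ_{2^{a+2}})`, the dihedral / semidihedral / modular CM closures of 2-power degree).

References: [cite: Pohlmann1968, Thm. 1]; [cite: Milne1999LefschetzClasses, Thm. 3.2, Prop. 2.1]; [cite: Shimura1998, §6.2 Theorem 3 (pp. 41–43)].
-/

noncomputable section

open Finset
open Summit.HodgeConjecture.CorCM.Prior.AllgGroup.RfwfAllgGroup
open Summit.HodgeConjecture.CorCM.FaceCensus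
open Summit.HodgeConjecture.CorCM.Census.BlockParity
open Summit.HodgeConjecture.CorCM.Census.TypeStabiliser
open Summit.HodgeConjecture.CorCM.Census.Coinvariant

namespace Summit.HodgeConjecture.CorCM.Census.IndexTwoCyclic

variable {G : Type*} [Group G] [Fintype G] [DecidableEq G] {c : G} {n : ℕ} [NeZero n]
variable (D : Datum G c n) (hc2 : c * c = 1) (hc1 : c ≠ 1)

/-! ## §1 The involution dichotomy at 2-power level -/

omit [Fintype G] [DecidableEq G] in
include D hc2 in
/-- **At 2-power level `n = 2ᵃ`, `c ∉ ⟨u^{r+1}⟩` forces `2n ∣ r + 1`** (i.e. `u^{r+1} = 1`, `r ≡ −1`): `c` lies in every non-trivial subgroup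
of the cyclic 2-group `⟨u⟩`. [folklore] -/
theorem two_mul_dvd_r_add_one_of_notMem {a : ℕ} (ha : n = 2 ^ a) (h : c ∉ Subgroup.zpowers (D.u ^ (D.r + 1))) : 2 * n ∣ D.r + 1 := by
  by_contra hnd
  apply h
  have hk0 : (D.r + 1) % (2 * n) ≠ 0 := fun h0 => hnd (Nat.dvd_of_mod_eq_zero h0)
  have hk : (D.r + 1) % (2 * n) < 2 * n := Nat.mod_lt _ (by have := NeZero.ne n; omega)
  have hmem := c_mem_zpowers_pow D hc2 ha hk0 hk
  rwa [← D.hord, pow_mod_orderOf] at hmem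

omit [DecidableEq G] in
include D in
/-- **If `2n ∣ r + 1` every element outside `⟨u⟩` is an involution**: `(uⁱ·w)² = u^{(r+1)i} = 1`. [folklore] -/
theorem mul_self_eq_one_of_dvd (hdvd : 2 * n ∣ D.r + 1) (x : G) (hx : x ∉ Subgroup.zpowers D.u) : x * x = 1 := by
  obtain ⟨i, -, hi⟩ := D.exists_pow_or_pow_mul_w x
  rcases hi with rfl | rfl
  · exact absurd (Subgroup.npow_mem_zpowers D.u i) hx
  · obtain ⟨m, hm⟩ := hdvd
    rw [pow_mul_w_mul_self D i, hm, mul_assoc, pow_mul, ← D.hord, pow_orderOf_eq_one, one_pow]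

omit [DecidableEq G] in
include D in
/-- **The dihedral datum** when `2n ∣ r + 1` (seat b23 gen 48ʼs `Dihedral.Datum`, same `u, w`). [folklore] -/
theorem nonempty_dihedralDatum_of_dvd (hdvd : 2 * n ∣ D.r + 1) :
    ∃ E : Dihedral.Datum G c n, E.g = D.u ∧ E.s = D.w :=
  ⟨⟨D.u, D.w, D.hun, D.hord, D.hindex, D.hw, mul_self_eq_one_of_dvd D hdvd⟩, rfl, rfl⟩

omit [DecidableEq G] in
include D hc2 in
/-- **THE DICHOTOMY at 2-power level**: either the twist hypothesis `c ∈ ⟨u^{r+1}⟩` holds, or `D` is dihedral (every non-rotation an involution).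
[folklore] -/
theorem mem_zpowers_twist_or_dihedral {a : ℕ} (ha : n = 2 ^ a) :
    c ∈ Subgroup.zpowers (D.u ^ (D.r + 1)) ∨ ∃ E : Dihedral.Datum G c n, E.g = D.u ∧ E.s = D.w := by
  by_cases h : c ∈ Subgroup.zpowers (D.u ^ (D.r + 1))
  · exact Or.inl h
  · exact Or.inr (nonempty_dihedralDatum_of_dvd D (two_mul_dvd_r_add_one_of_notMem D hc2 ha h))

/-! ## §2 `μ = φ₂` for every twist -/

omit [NeZero n] in
/-- `2ᵃ` is even for `a ≠ 0` (file-local arithmetic). -/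
private theorem even_of_two_pow {a : ℕ} (ha : n = 2 ^ a) (ha0 : a ≠ 0) : Even n := by
  rw [ha]; exact Nat.even_pow.mpr ⟨even_two, ha0⟩

include D hc1 in
/-- **THE INDEX-TWO CYCLIC CENSUS AT 2-POWER LEVEL: `μ(ℤ/2^{a+1} ⋊_r ℤ/2, u^{2ᵃ}) = φ₂` FOR EVERY TWIST `r`** (`a ≥ 1`).  The least number of
rank-four face relations whose base changes generate the integer Hodge lattice modulo the pairs is EXACTLY the coinvariant count `φ₂(G, c)`:
`β − 1` on the twist side `c ∈ ⟨u^{r+1}⟩` (abelian, modular, semidihedral, …; this seatʼs law), `β − 2` on the dihedral side (seat b23 gen 48).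
[folklore] -/
theorem isLeast_card_gfaces_generate_fibreTwo_of_two_pow {a : ℕ} (ha : n = 2 ^ a) (ha0 : a ≠ 0) :
    IsLeast {m : ℕ | ∃ S : Finset (CMF G c →₀ ℤ), ↑S ⊆ gfaceSet G c hc2 ∧ S.card = m ∧
      hodgeSpan c hc2 ≤ Submodule.span ℤ (pairSet c) ⊔ Submodule.span ℤ (translates c S)} (fibreTwo c hc2) := by
  rcases mem_zpowers_twist_or_dihedral D hc2 ha with h | ⟨E, -, -⟩
  · exact isLeast_card_gfaces_generate_fibreTwo_of_twist D hc2 hc1 (even_of_two_pow ha ha0) h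
  · exact Dihedral.isLeast_card_gfaces_generate_fibreTwo E hc2 hc1

include D hc1 in
/-- **Block currency: `μ = β − (1 if c ∈ ⟨u^{r+1}⟩ else 2)`** at 2-power level, every twist. [folklore] -/
theorem isLeast_card_gfaces_generate_of_two_pow {a : ℕ} (ha : n = 2 ^ a) (ha0 : a ≠ 0) :
    IsLeast {m : ℕ | ∃ S : Finset (CMF G c →₀ ℤ), ↑S ⊆ gfaceSet G c hc2 ∧ S.card = m ∧
      hodgeSpan c hc2 ≤ Submodule.span ℤ (pairSet c) ⊔ Submodule.span ℤ (translates c S)}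
      (Fintype.card (Block c) - if c ∈ Subgroup.zpowers (D.u ^ (D.r + 1)) then 1 else 2) := by
  rw [card_block_eq_fibreTwo_add D hc2 hc1 (even_of_two_pow ha ha0), Nat.add_sub_cancel]
  exact isLeast_card_gfaces_generate_fibreTwo_of_two_pow D hc2 hc1 ha ha0

include D hc1 in
/-- **The dihedral side in this seatʼs vocabulary**: if `c ∉ ⟨u^{r+1}⟩` at 2-power level then `μ = β − 2` EXACTLY. [folklore] -/
theorem isLeast_card_gfaces_generate_of_notMem_two_pow {a : ℕ} (ha : n = 2 ^ a) (h : c ∉ Subgroup.zpowers (D.u ^ (D.r + 1))) :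
    IsLeast {m : ℕ | ∃ S : Finset (CMF G c →₀ ℤ), ↑S ⊆ gfaceSet G c hc2 ∧ S.card = m ∧
      hodgeSpan c hc2 ≤ Submodule.span ℤ (pairSet c) ⊔ Submodule.span ℤ (translates c S)} (Fintype.card (Block c) - 2) := by
  obtain ⟨E, -, -⟩ := nonempty_dihedralDatum_of_dvd D (two_mul_dvd_r_add_one_of_notMem D hc2 ha h)
  exact Dihedral.isLeast_card_gfaces_generate E hc2 hc1

omit [NeZero n] in
include hc1 in
/-- **STRUCTURE-FREE FORM**: in a finite group, `u` of order `2^{a+1}` (`a ≥ 1`) generating a subgroup of index two, `c = u^{2ᵃ}`, and an involution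
`w ∉ ⟨u⟩` — then `μ(G, c) = φ₂(G, c)`, whatever the twist. [folklore] -/
theorem isLeast_card_gfaces_generate_fibreTwo_of_involution_two_pow (u w : G) {a : ℕ} (ha : n = 2 ^ a) (ha0 : a ≠ 0) (hun : u ^ n = c)
    (hord : orderOf u = 2 * n) (hindex : (Subgroup.zpowers u).index = 2) (hw : w ∉ Subgroup.zpowers u) (hww : w * w = 1) :
    IsLeast {m : ℕ | ∃ S : Finset (CMF G c →₀ ℤ), ↑S ⊆ gfaceSet G c hc2 ∧ S.card = m ∧
      hodgeSpan c hc2 ≤ Submodule.span ℤ (pairSet c) ⊔ Submodule.span ℤ (translates c S)} (fibreTwo c hc2) := by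
  haveI : NeZero n := ⟨by rw [ha]; positivity⟩
  obtain ⟨D, -, -⟩ := exists_datum_of_involution (c := c) u w hun hord hindex hw hww
  exact isLeast_card_gfaces_generate_fibreTwo_of_two_pow D hc2 hc1 ha ha0

end Summit.HodgeConjecture.CorCM.Census.IndexTwoCyclic

/-! ## §3 Field level: every Galois CM field of 2-power degree with a split index-two cyclic Galois datum -/

namespace Summit.HodgeConjecture.CorCM.FaceIndexTwoCyclic

open NumberField NumberField.ComplexEmbedding
open Literature.AlgebraicGeometry.ComplexMultiplication
open Summit.HodgeConjecture.CorCM.Domination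
open Summit.HodgeConjecture.CorCM.Census

variable {F : Type} [Field F] [NumberField F] {n : ℕ} [NeZero n]

/-- Complex conjugation is central in `GalT F` along the datum (file-local). [folklore] -/
private theorem conjT_comm₂ (D : IndexTwoCyclic.Datum (GalT F) conjT n) (y : GalT F) : y * conjT = conjT * y := by
  have h := D.comm_pow_n y
  rwa [D.hun] at h

/-- **EVERY GALOIS CM FIELD WITH A SPLIT INDEX-TWO CYCLIC GALOIS DATUM OF 2-POWER LEVEL HAS EXACTLY `φ₂(F)` GENERATING FACES** (datum form,
every twist). [folklore] -/
theorem isLeast_card_faces_hgen_of_two_pow [IsCMField F] [IsGalois ℚ F] (D : IndexTwoCyclic.Datum (GalT F) conjT n) {a : ℕ} (ha : n = 2 ^ a)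
    (ha0 : a ≠ 0) (σ₀ : F →+* ℂ) :
    IsLeast {m : ℕ | ∃ 𝒮 : Finset (Face F), 𝒮.card = m ∧
      ∀ f : Face F, lefChar f.corner (fun _ => ({σ₀} : Finset (F →+* ℂ))) ∈ AddSubgroup.closure
        {a : Asym F | ∃ g ∈ (𝒮 : Set (Face F)), ∃ σ : F →+* ℂ, a = lefChar g.corner (fun _ => ({σ} : Finset (F →+* ℂ)))}}
      (fibreTwo (conjT : GalT F) conjT_mul_self) := by
  refine FaceTransfer.isLeast_card_faces_hgen_of_intrinsic _ ?_ (fun S₀ hS₀ hS => ?_) σ₀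
  · obtain ⟨S, hS, hcard, hgen⟩ :=
      (IndexTwoCyclic.isLeast_card_gfaces_generate_fibreTwo_of_two_pow D conjT_mul_self conjT_ne_one ha ha0).1
    exact ⟨S, hS, hcard.le, hgen⟩
  · exact fibreTwo_le_card conjT conjT_mul_self (conjT_comm₂ D) S₀ (Submodule.span ℤ (pairSet conjT)) le_rfl hS₀
      (fun y hy => hS (gfaceSet_subset_hodgeSpan conjT conjT_mul_self hy))

/-- **… from `u₀, w₀ ∈ Aut(F)` alone**: `[F:ℚ] = 2^{a+2}` (`a ≥ 1`), `u₀` of order `2^{a+1}` with `u₀^{2ᵃ}` inducing complex conjugation at `σ₀`,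
an involution `w₀ ∉ ⟨u₀⟩` — EXACTLY `φ₂(F)` generating faces, whatever the twist (cyclotomic `ℚ(ζ_{2^{a+2}})`, dihedral, semidihedral, modular
CM closures of 2-power degree, …). [folklore] -/
theorem isLeast_card_faces_hgen_of_aut_two_pow [IsCMField F] [IsGalois ℚ F] (σ₀ : F →+* ℂ) (u₀ w₀ : F ≃ₐ[ℚ] F) {a : ℕ} (ha : n = 2 ^ a)
    (ha0 : a ≠ 0) (hord : orderOf u₀ = 2 * n) (hcσ : σ₀.comp ((u₀ ^ n : F ≃ₐ[ℚ] F) : F →+* F) = conjugate σ₀)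
    (hw : w₀ ∉ Subgroup.zpowers u₀) (hww : w₀ * w₀ = 1) (hdeg : Module.finrank ℚ F = 4 * n) :
    IsLeast {m : ℕ | ∃ 𝒮 : Finset (Face F), 𝒮.card = m ∧
      ∀ f : Face F, lefChar f.corner (fun _ => ({σ₀} : Finset (F →+* ℂ))) ∈ AddSubgroup.closure
        {a : Asym F | ∃ g ∈ (𝒮 : Set (Face F)), ∃ σ : F →+* ℂ, a = lefChar g.corner (fun _ => ({σ} : Finset (F →+* ℂ)))}}
      (fibreTwo (conjT : GalT F) conjT_mul_self) := by
  obtain ⟨D, -, -, -⟩ := exists_datum_of_aut_involution σ₀ u₀ w₀ hord hcσ hw hww hdeg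
  exact isLeast_card_faces_hgen_of_two_pow D ha ha0 σ₀

end Summit.HodgeConjecture.CorCM.FaceIndexTwoCyclic
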